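import Summits.Ventures.HSemireg.WedgeHankelRecurrenceGaussSecondKindZeros

/-!
# Venture HSemireg — **MARKOV–STIELTJES REMAINDER FOR THE STIELTJES TRANSFORM**: if `(λ, z)` is exact for `(ν, w)` in degree `≤ 2t + 1` (e.g. the Gauss rule) and `ω = ∏_k (X − z_k)` is its node
# polynomial, then for every real `x` off the nodes and atoms
# `Σ_l ν_l ∕ (x − w_l) − Σ_k λ_k ∕ (x − z_k) = (Σ_l ν_l ω(w_l)² ∕ (x − w_l)) ∕ ω(x)²`;
# hence the Gauss approximant of the Stieltjes transform UNDERESTIMATES it to the right of the support and OVERESTIMATES it to the left (`ν ≥ 0` with an atom off the nodes: strictly)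

HONEST FRAMING. Part of the Lean index of the computation cell `pub-hsemireg` (seat p10 gen 43, Sunday typer «UNIFORM-IN-n»).  Real polynomials, finite sums and divisions by non-zero reals only;
no variety, no cohomology theory, no sheaf, no Ext group and no semiregularity map is constructed here; nothing here says that HC / HC_CM / HC_AV holds; no Literature fact (unproved `Prop`) is
declared or used.  Custodian versions as in `WedgeHankelSiegelIdeal` (1/3).
SOURCES (cited).  A. A. Markov, *Sur la méthode de Gauss pour le calcul approché des intégrales*, Math. Ann. 25 (1885) 427–432; T. J. Stieltjes, *Quelques recherches sur la théorie des quadratures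
dites mécaniques*, Ann. Sci. ÉNS (3) 1 (1884) 409–426, and *Recherches sur les fractions continues* (1894) §§ 47–49 (the convergents bracket the transform); C. Posse, *Sur les quadratures*, Nouv.
Ann. Math. (2) 14 (1875); G. Szegő, *Orthogonal Polynomials*, Thm 3.5.4 ∕ (3.5.8) and Thm 15.2.2 (Markov–Stieltjes); G. Freud, *Orthogonal Polynomials*, §III.1.
PROOF TYPED HERE.  `ω − ω(x) = (X − x) D` (N307 `exists_quotient_sub_eval`), so `1 ∕ (x − s) = D(s) ∕ ω(x) + ω(s) ∕ (ω(x)(x − s))`; exactness on `D` (`deg D ≤ t`) and `ω(z_k) = 0` give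
`Σ λ ∕ (x − z) = Σ λ D(z) ∕ ω(x) = Σ ν D(w) ∕ ω(x)`, and N307 `eval_mul_secondKindSum_eq` (`ω(x) Σ ν ω(w) ∕ (w − x) = Σ ν ω(w)² ∕ (w − x)`, valid since `ω ⟂` lower degrees by N265) turns the
remainder into the square form.
DEDUP DISCLOSURE (`rg -n 'stieltjes_remainder|transform_sub_gauss|markov_remainder' Summits/Ventures/HSemireg`, 2026-09-03): N284 ∕ N310 identify the Gauss side with `r ∕ q`; N307 has the `F_n`
identity; the remainder formula and its sign are new.  The 3 names below: 0 hits tree-wide.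

WHAT IS IN THE TREE.  N239 `sum_mul_eval_eq_of_moments_eq`; N265 `sum_mul_eval_nodePoly_mul_eq_zero`; N307 `exists_quotient_sub_eval`, `eval_mul_secondKindSum_eq`; Mathlib `Finset.sum_div`, `div_add_div`,
`Finset.sum_pos`.
THIS FILE (namespace `Summit.Ventures.HSemireg.Wedge.HankelOuter` continued; CHAINED on N313 (import), N239, N265, N307; 0 definitions):
* §1079 **`stieltjes_transform_sub_gauss_eq`** (THE REMAINDER FORMULA), **`gauss_stieltjes_lt_of_right`** (for `ν ≥ 0` with some `ν_{l₀} > 0` at an atom off the nodes and `x > w_l`, `x > z_k` for all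
  `l, k`: `Σ_k λ_k ∕ (x − z_k) < Σ_l ν_l ∕ (x − w_l)`), **`gauss_stieltjes_gt_of_left`** (for `x` to the left of all atoms and nodes the inequality reverses).
CAVEATS.  Only exactness in degree `≤ 2t + 1` is used for the identity (no positivity, no distinctness of the nodes).  Nothing Ext-side.  New names only.
-/

open Module Polynomial
open scoped Matrix Polynomial

namespace Summit.Ventures.HSemireg.Wedge.HankelOuter

/-! ## §1079. The Markov–Stieltjes remainder for `Σ ν ∕ (x − w)` -/

/-- **MARKOV–STIELTJES REMAINDER FORMULA.**  Let `(λ, z)` (`t + 1` nodes) be exact for `(ν, w)` in degree `≤ 2t + 1`, `ω = ∏_k (X − z_k)`, and let `x` be a real number with `ω(x) ≠ 0` and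
`x ≠ w_l` for all `l`.  Then `Σ_l ν_l ∕ (x − w_l) − Σ_k λ_k ∕ (x − z_k) = (Σ_l ν_l ω(w_l)² ∕ (x − w_l)) ∕ ω(x)²`. [Markov 1885; Stieltjes 1884; Szegő (3.5.8) ∕ Thm 15.2.2; this file, §1079] -/
theorem stieltjes_transform_sub_gauss_eq {t N : ℕ} {μ z : Fin (t + 1) → ℝ} {ν w : Fin N → ℝ}
    (hmom : ∀ p, p ≤ 2 * t + 1 → ∑ k, μ k * z k ^ p = ∑ l, ν l * w l ^ p) {x : ℝ} (hx : (∏ k, (Polynomial.X - C (z k))).eval x ≠ 0) (hxw : ∀ l, w l ≠ x) :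
    ∑ l, ν l / (x - w l) - ∑ k, μ k / (x - z k) =
      (∑ l, ν l * ((∏ k, (Polynomial.X - C (z k))).eval (w l)) ^ 2 / (x - w l)) / ((∏ k, (Polynomial.X - C (z k))).eval x) ^ 2 := by
  set ω : ℝ[X] := ∏ k, (Polynomial.X - C (z k)) with hω
  have hωd : ω.natDegree = t + 1 := by
    rw [hω, natDegree_prod_of_monic _ _ fun k _ => monic_X_sub_C (z k)]
    simp only [natDegree_X_sub_C, Finset.sum_const, Finset.card_univ, Fintype.card_fin, smul_eq_mul, mul_one]
  have hωz : ∀ k, ω.eval (z k) = 0 := fun k => by rw [hω, eval_prod]; exact Finset.prod_eq_zero (Finset.mem_univ k) (by simp)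
  have hxz : ∀ k, x - z k ≠ 0 := fun k h => by
    have : x = z k := sub_eq_zero.1 h
    exact hx (by rw [this]; exact hωz k)
  -- `ω − ω(x) = (X − x) D`, `deg D ≤ t`
  obtain ⟨D, hD, hDd⟩ := exists_quotient_sub_eval ω x
  have hDd' : D.natDegree < 2 * t + 2 := by rw [hωd] at hDd; omega
  have hmom' : ∀ p, p < 2 * t + 2 → ∑ k, μ k * z k ^ p = ∑ l, ν l * w l ^ p := fun p hp => hmom p (by omega)
  have hexD : ∑ k, μ k * D.eval (z k) = ∑ l, ν l * D.eval (w l) := sum_mul_eval_eq_of_moments_eq hmom' hDd'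
  have hev : ∀ s, ω.eval s - ω.eval x = (s - x) * D.eval s := fun s => by
    have h := congrArg (fun F => F.eval s) hD
    simp only [eval_sub, eval_mul, eval_X, eval_C] at h
    exact h
  -- on the nodes: `λ_k ∕ (x − z_k) = λ_k D(z_k) ∕ ω(x)`
  have hnode : ∀ k, μ k / (x - z k) = μ k * D.eval (z k) / ω.eval x := fun k => by
    have h := hev (z k)
    rw [hωz k, zero_sub] at h
    rw [div_eq_div_iff (hxz k) hx]
    linear_combination (-μ k) * h
  -- on the atoms: `ν_l ∕ (x − w_l) = (ν_l D(w_l) + ν_l ω(w_l) ∕ (x − w_l)) ∕ ω(x)`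
  have hatom : ∀ l, ν l / (x - w l) = (ν l * D.eval (w l) + ν l * ω.eval (w l) / (x - w l)) / ω.eval x := fun l => by
    have hxw' : x - w l ≠ 0 := sub_ne_zero.2 (hxw l).symm
    have hωx : ω.eval x = ω.eval (w l) + (x - w l) * D.eval (w l) := by linarith [hev (w l)]
    rw [eq_div_iff hx, hωx]
    field_simp
    ring
  rw [Finset.sum_congr rfl fun l _ => hatom l, Finset.sum_congr rfl fun k _ => hnode k, ← Finset.sum_div, ← Finset.sum_div, Finset.sum_add_distrib, hexD, ← sub_div,
    add_sub_cancel_left]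
  -- `ω(x) Σ ν ω(w) ∕ (w − x) = Σ ν ω(w)² ∕ (w − x)` (N307 with `c = x`; orthogonality of `ω` from exactness, N265)
  have horth : ∀ G : ℝ[X], G.natDegree < t + 1 → ∑ l, ν l * (ω * G).eval (w l) = 0 := fun G hG => sum_mul_eval_nodePoly_mul_eq_zero hmom (by omega)
  have hF := eval_mul_secondKindSum_eq hωd horth hxw
  have hflip : ∀ l, ν l * ω.eval (w l) / (x - w l) = -(ν l * ω.eval (w l) / (w l - x)) := fun l => by
    rw [← div_neg, neg_sub]
  have hflip2 : ∀ l, ν l * (ω.eval (w l)) ^ 2 / (x - w l) = -(ν l * (ω.eval (w l)) ^ 2 / (w l - x)) := fun l => by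
    rw [← div_neg, neg_sub]
  rw [Finset.sum_congr rfl fun l _ => hflip l, Finset.sum_congr rfl fun l _ => hflip2 l, Finset.sum_neg_distrib, Finset.sum_neg_distrib, ← hF]
  field_simp

/-- **To the right of the support the Gauss approximant underestimates the Stieltjes transform**: with `ν ≥ 0`, some `ν_{l₀} > 0` at an atom `w_{l₀}` that is not a node, and `x > w_l`, `x > z_k` for all
`l, k`: `Σ_k λ_k ∕ (x − z_k) < Σ_l ν_l ∕ (x − w_l)`. [Markov 1885; Stieltjes 1894 §47; Szegő Thm 3.5.4; this file, §1079] -/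
theorem gauss_stieltjes_lt_of_right {t N : ℕ} {μ z : Fin (t + 1) → ℝ} {ν w : Fin N → ℝ} (hν : ∀ l, 0 ≤ ν l) {l₀ : Fin N} (hl₀ : 0 < ν l₀)
    (hw₀ : ∀ k, w l₀ ≠ z k) (hmom : ∀ p, p ≤ 2 * t + 1 → ∑ k, μ k * z k ^ p = ∑ l, ν l * w l ^ p) {x : ℝ} (hxw : ∀ l, w l < x) (hxz : ∀ k, z k < x) :
    ∑ k, μ k / (x - z k) < ∑ l, ν l / (x - w l) := by
  have hωx : (∏ k, (Polynomial.X - C (z k))).eval x ≠ 0 := by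
    rw [eval_prod]; exact Finset.prod_ne_zero_iff.2 fun k _ => by rw [eval_sub, eval_X, eval_C]; exact sub_ne_zero.2 (hxz k).ne'
  have h := stieltjes_transform_sub_gauss_eq hmom hωx (fun l => (hxw l).ne)
  have hωw : (∏ k, (Polynomial.X - C (z k))).eval (w l₀) ≠ 0 := by
    rw [eval_prod]; exact Finset.prod_ne_zero_iff.2 fun k _ => by rw [eval_sub, eval_X, eval_C]; exact sub_ne_zero.2 (hw₀ k)
  have hnum : 0 < ∑ l, ν l * ((∏ k, (Polynomial.X - C (z k))).eval (w l)) ^ 2 / (x - w l) :=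
    Finset.sum_pos' (fun l _ => div_nonneg (mul_nonneg (hν l) (sq_nonneg _)) (sub_pos.2 (hxw l)).le)
      ⟨l₀, Finset.mem_univ _, div_pos (mul_pos hl₀ (lt_of_le_of_ne (sq_nonneg _) (Ne.symm (pow_ne_zero 2 hωw)))) (sub_pos.2 (hxw l₀))⟩
  have hden : 0 < ((∏ k, (Polynomial.X - C (z k))).eval x) ^ 2 := lt_of_le_of_ne (sq_nonneg _) (Ne.symm (pow_ne_zero 2 hωx))
  have key : 0 < ∑ l, ν l / (x - w l) - ∑ k, μ k / (x - z k) := by rw [h]; exact div_pos hnum hden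
  exact sub_pos.1 key

/-- **To the left of the support the Gauss approximant overestimates the Stieltjes transform**: with `ν ≥ 0`, some `ν_{l₀} > 0` at an atom off the nodes, and `x < w_l`, `x < z_k` for all `l, k`:
`Σ_l ν_l ∕ (x − w_l) < Σ_k λ_k ∕ (x − z_k)`. [Markov 1885; Stieltjes 1894 §47; Szegő Thm 3.5.4; this file, §1079] -/
theorem gauss_stieltjes_gt_of_left {t N : ℕ} {μ z : Fin (t + 1) → ℝ} {ν w : Fin N → ℝ} (hν : ∀ l, 0 ≤ ν l) {l₀ : Fin N} (hl₀ : 0 < ν l₀)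
    (hw₀ : ∀ k, w l₀ ≠ z k) (hmom : ∀ p, p ≤ 2 * t + 1 → ∑ k, μ k * z k ^ p = ∑ l, ν l * w l ^ p) {x : ℝ} (hxw : ∀ l, x < w l) (hxz : ∀ k, x < z k) :
    ∑ l, ν l / (x - w l) < ∑ k, μ k / (x - z k) := by
  have hωx : (∏ k, (Polynomial.X - C (z k))).eval x ≠ 0 := by
    rw [eval_prod]; exact Finset.prod_ne_zero_iff.2 fun k _ => by rw [eval_sub, eval_X, eval_C]; exact sub_ne_zero.2 (hxz k).ne
  have h := stieltjes_transform_sub_gauss_eq hmom hωx (fun l => (hxw l).ne')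
  have hωw : (∏ k, (Polynomial.X - C (z k))).eval (w l₀) ≠ 0 := by
    rw [eval_prod]; exact Finset.prod_ne_zero_iff.2 fun k _ => by rw [eval_sub, eval_X, eval_C]; exact sub_ne_zero.2 (hw₀ k)
  have hnum : ∑ l, ν l * ((∏ k, (Polynomial.X - C (z k))).eval (w l)) ^ 2 / (x - w l) < 0 := by
    have hneg : ∀ l, ν l * ((∏ k, (Polynomial.X - C (z k))).eval (w l)) ^ 2 / (x - w l) ≤ 0 := fun l =>
      div_nonpos_of_nonneg_of_nonpos (mul_nonneg (hν l) (sq_nonneg _)) (sub_neg.2 (hxw l)).le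
    have hstrict : ν l₀ * ((∏ k, (Polynomial.X - C (z k))).eval (w l₀)) ^ 2 / (x - w l₀) < 0 :=
      div_neg_of_pos_of_neg (mul_pos hl₀ (lt_of_le_of_ne (sq_nonneg _) (Ne.symm (pow_ne_zero 2 hωw)))) (sub_neg.2 (hxw l₀))
    have hsum : 0 < ∑ l, -(ν l * ((∏ k, (Polynomial.X - C (z k))).eval (w l)) ^ 2 / (x - w l)) :=
      Finset.sum_pos' (fun l _ => neg_nonneg.2 (hneg l)) ⟨l₀, Finset.mem_univ _, neg_pos.2 hstrict⟩
    rw [Finset.sum_neg_distrib] at hsum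
    exact neg_pos.1 hsum
  have hden : 0 < ((∏ k, (Polynomial.X - C (z k))).eval x) ^ 2 := lt_of_le_of_ne (sq_nonneg _) (Ne.symm (pow_ne_zero 2 hωx))
  have key : ∑ l, ν l / (x - w l) - ∑ k, μ k / (x - z k) < 0 := by rw [h]; exact div_neg_of_neg_of_pos hnum hden
  exact sub_neg.1 key

end Summit.Ventures.HSemireg.Wedge.HankelOuter
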